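import Summits.Ventures.HodgeRepro2.T5HeckeIsomorphismTransportCells
import Summits.Ventures.HodgeRepro2.T5UnitaryHeckeAdjoint

/-!
# Transport of «the Hecke algebra is generated by the double coset of `g`» along group isomorphisms

Tier-5 support N3 / §G-N4.2 (seat p3, gen 77). Seat p8's T5-142 / T5-144 transport the spherical Hecke algebra
`H(G, K)` along a group isomorphism `φ : G ≃* G'` matching `K` with `K'` (`heckeAlgebraEquivOfMulEquiv`) and send
double-coset operators to double-coset operators (`heckeAlgebraEquivOfMulEquiv_doubleCosetOp : ε(T_g) = T_{φ g}`).
This file adds the small generic lemmas needed to carry the statement «`aeval T_g : k[X] →ₐ[k] H(G, K)` is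
bijective» (file 187's `aeval_bijective`, the algebra half of Satake) across such a transport, across an equality
of subgroups, and back along `φ.symm`, together with the finiteness of the orbit that `doubleCosetOp` needs:

* `bijective_aeval_of_eq`, `bijective_aeval_algEquiv_apply` — `aeval x` bijective ⇒ `aeval y` bijective for `x = y`,
  and ⇒ `aeval (e x)` bijective for an algebra isomorphism `e`;
* `doubleCosetOp_congr`, `bijective_aeval_doubleCosetOp_of_eq` — congruence in `g` and in `K`;
* `finite_orbit_of_mulEquiv` — the orbit of `gK` is finite when that of `φ g K'` is (T5-144's image formula);
* **`bijective_aeval_doubleCosetOp_symm`** — if `T_{g'}` generates `H(G', K')` then `T_{φ⁻¹ g'}` generates `H(G, K)`;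
* `conj_mem_formUnitaryGroup` — `Pᴴ H P = J` and `g ∈ U(J)` give `P g P⁻¹ ∈ U(H)` (the change of basis of the
  hermitian form moves the unitary group by conjugation).

§8(d): uses an L-value-free non-vanishing device: NO.
-/

open Polynomial MulAction Matrix
open Summit.Ventures.HodgeRepro2.T5HeckePermutationModule Summit.Ventures.HodgeRepro2.T5HeckeDoubleCoset
  Summit.Ventures.HodgeRepro2.T5HeckeIsomorphismTransport Summit.Ventures.HodgeRepro2.T5HeckeIsomorphismTransportCells
  Summit.Ventures.HodgeRepro2.T5UnitaryGroupForm

namespace Summit.Ventures.HodgeRepro2.T5HeckeGeneratorTransport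

section Algebra

variable {k A B : Type*} [CommSemiring k] [Semiring A] [Semiring B] [Algebra k A] [Algebra k B]

/-- `aeval (e x) = e ∘ aeval x` for an algebra isomorphism `e`. -/
theorem coe_aeval_algEquiv_apply (e : A ≃ₐ[k] B) (x : A) :
    ⇑(aeval (e x) : k[X] →ₐ[k] B) = ⇑e ∘ ⇑(aeval x : k[X] →ₐ[k] A) :=
  funext fun p => by
    rw [Function.comp_apply, ← AlgEquiv.coe_toAlgHom, Polynomial.aeval_algHom_apply]

/-- Bijectivity of `aeval` is carried across an equality of generators (stated generically so that the rewrite never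
touches a concrete Hecke-algebra type). -/
theorem bijective_aeval_of_eq {x y : A} (h : x = y) (hx : Function.Bijective (aeval x : k[X] →ₐ[k] A)) :
    Function.Bijective (aeval y : k[X] →ₐ[k] A) := by
  subst h
  exact hx

/-- A generator is carried to a generator by an algebra isomorphism. -/
theorem bijective_aeval_algEquiv_apply (e : A ≃ₐ[k] B) {x : A}
    (h : Function.Bijective (aeval x : k[X] →ₐ[k] A)) :
    Function.Bijective (aeval (e x) : k[X] →ₐ[k] B) := by
  rw [coe_aeval_algEquiv_apply]
  exact e.bijective.comp h

end Algebra

section Transport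

variable {G : Type*} [Group G] (k : Type*) [Field k]

/-- `doubleCosetOp` depends only on the element (the finiteness witnesses are proofs). -/
theorem doubleCosetOp_congr (K : Subgroup G) {g g' : G} (h : g = g') [Finite (orbit K (g : G ⧸ K))]
    [Finite (orbit K (g' : G ⧸ K))] : doubleCosetOp k K g = doubleCosetOp k K g' := by
  subst h
  rfl

/-- Bijectivity of `aeval T_g` is carried across an equality of subgroups. -/
theorem bijective_aeval_doubleCosetOp_of_eq {K₁ K₂ : Subgroup G} (h : K₁ = K₂) (g : G)
    [Finite (orbit K₁ (g : G ⧸ K₁))] [Finite (orbit K₂ (g : G ⧸ K₂))]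
    (hb : Function.Bijective (aeval (doubleCosetOp k K₁ g) : k[X] →ₐ[k] heckeAlgebra k K₁)) :
    Function.Bijective (aeval (doubleCosetOp k K₂ g) : k[X] →ₐ[k] heckeAlgebra k K₂) := by
  subst h
  exact hb

variable {G' : Type*} [Group G'] (φ : G ≃* G') {K : Subgroup G} {K' : Subgroup G'}

/-- The orbit of `gK` is finite when the orbit of `φ g K'` is (T5-144's `quotientEquivOfMulEquiv_image_orbit`). -/
theorem finite_orbit_of_mulEquiv (hK : ∀ g : G, g ∈ K ↔ φ g ∈ K') (g : G)
    [Finite (orbit K' ((φ g : G') : G' ⧸ K'))] :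
    Finite (orbit K (g : G ⧸ K)) := by
  have himg : (⇑(quotientEquivOfMulEquiv φ hK) '' orbit K (g : G ⧸ K)).Finite := by
    rw [quotientEquivOfMulEquiv_image_orbit]
    exact Set.toFinite _
  exact (himg.of_finite_image (quotientEquivOfMulEquiv φ hK).injective.injOn).to_subtype

/-- **Transport of the generator back along `φ⁻¹`**: if `T_{g'}` generates `H(G', K')` (`aeval T_{g'}` bijective),
then `T_{φ⁻¹ g'}` generates `H(G, K)` — `ε(T_{φ⁻¹ g'}) = T_{g'}` for `ε = heckeAlgebraEquivOfMulEquiv k φ hK`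
(T5-144), so `T_{φ⁻¹ g'} = ε⁻¹(T_{g'})`. -/
theorem bijective_aeval_doubleCosetOp_symm (hK : ∀ g : G, g ∈ K ↔ φ g ∈ K') (g' : G')
    [Finite (orbit K' (g' : G' ⧸ K'))]
    [Finite (orbit K ((φ.symm g' : G) : G ⧸ K))]
    [Finite (orbit K' ((φ (φ.symm g') : G') : G' ⧸ K'))]
    (hb : Function.Bijective (aeval (doubleCosetOp k K' g') : k[X] →ₐ[k] heckeAlgebra k K')) :
    Function.Bijective (aeval (doubleCosetOp k K (φ.symm g')) : k[X] →ₐ[k] heckeAlgebra k K) := by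
  have h1 : heckeAlgebraEquivOfMulEquiv k φ hK (doubleCosetOp k K (φ.symm g')) = doubleCosetOp k K' g' := by
    rw [heckeAlgebraEquivOfMulEquiv_doubleCosetOp k φ hK (φ.symm g')]
    exact doubleCosetOp_congr k K' (φ.apply_symm_apply g')
  have h2 : doubleCosetOp k K (φ.symm g') = (heckeAlgebraEquivOfMulEquiv k φ hK).symm (doubleCosetOp k K' g') := by
    rw [← h1, AlgEquiv.symm_apply_apply]
  rw [h2]
  exact bijective_aeval_algEquiv_apply _ hb

end Transport

section Conjugation

variable {E : Type*} [CommRing E] [StarRing E] {ι : Type*} [Fintype ι] [DecidableEq ι]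

/-- **Conjugation moves the unitary group of a form to that of the congruent form**: if `Pᴴ H P = J` and
`g ∈ U(J)` then `P g P⁻¹ ∈ U(H)` (`P` invertible). -/
theorem conj_mem_formUnitaryGroup {H J : Matrix ι ι E} (P : GL ι E) (hP : (P : Matrix ι ι E)ᴴ * H * P = J)
    {g : GL ι E} (hg : g ∈ formUnitaryGroup J) : P * g * P⁻¹ ∈ formUnitaryGroup H := by
  change ((P * g * P⁻¹ : GL ι E) : Matrix ι ι E)ᴴ * H * ((P * g * P⁻¹ : GL ι E) : Matrix ι ι E) = H
  change ((g : GL ι E) : Matrix ι ι E)ᴴ * J * ((g : GL ι E) : Matrix ι ι E) = J at hg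
  have hPi : ((P⁻¹ : GL ι E) : Matrix ι ι E) * (P : Matrix ι ι E) = 1 := by
    rw [← Units.val_mul, inv_mul_cancel, Units.val_one]
  have hPi' : (P : Matrix ι ι E) * ((P⁻¹ : GL ι E) : Matrix ι ι E) = 1 := by
    rw [← Units.val_mul, mul_inv_cancel, Units.val_one]
  have hH : H = ((P⁻¹ : GL ι E) : Matrix ι ι E)ᴴ * J * ((P⁻¹ : GL ι E) : Matrix ι ι E) := by
    rw [← hP]
    calc H = (((P⁻¹ : GL ι E) : Matrix ι ι E)ᴴ * (P : Matrix ι ι E)ᴴ) * H *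
          ((P : Matrix ι ι E) * ((P⁻¹ : GL ι E) : Matrix ι ι E)) := by
            rw [← Matrix.conjTranspose_mul, hPi', Matrix.conjTranspose_one, Matrix.one_mul, Matrix.mul_one]
      _ = ((P⁻¹ : GL ι E) : Matrix ι ι E)ᴴ * ((P : Matrix ι ι E)ᴴ * H * (P : Matrix ι ι E)) *
          ((P⁻¹ : GL ι E) : Matrix ι ι E) := by
            simp only [Matrix.mul_assoc]
  rw [Units.val_mul, Units.val_mul, Matrix.conjTranspose_mul, Matrix.conjTranspose_mul]
  calc ((P⁻¹ : GL ι E) : Matrix ι ι E)ᴴ * ((g : Matrix ι ι E)ᴴ * (P : Matrix ι ι E)ᴴ) * H *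
        ((P : Matrix ι ι E) * (g : Matrix ι ι E) * ((P⁻¹ : GL ι E) : Matrix ι ι E))
      = ((P⁻¹ : GL ι E) : Matrix ι ι E)ᴴ * ((g : Matrix ι ι E)ᴴ * ((P : Matrix ι ι E)ᴴ * H * (P : Matrix ι ι E)) *
          (g : Matrix ι ι E)) * ((P⁻¹ : GL ι E) : Matrix ι ι E) := by
          simp only [Matrix.mul_assoc]
    _ = ((P⁻¹ : GL ι E) : Matrix ι ι E)ᴴ * J * ((P⁻¹ : GL ι E) : Matrix ι ι E) := by
          rw [hP, hg]
    _ = H := hH.symm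

end Conjugation

end Summit.Ventures.HodgeRepro2.T5HeckeGeneratorTransport
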